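import Literature.Topology.FourManifolds.LickorishWallaceLeaves
import Literature.Topology.FourManifolds.OneHandleStepExists
import Literature.Topology.FourManifolds.CorkDecomposition
import Literature.Topology.FourManifolds.SPC4HandlesProofs
import Literature.Topology.FourManifolds.SmaleDiffDisc
import HarnessLib
import Literature.Topology.FourManifolds.HandlebodyKernelExtension

/-!
# Stub `stub_handlebodyExtension` of line `lp-by-sphere-system-surgery` for crux `AgkCor6Sufficiency`
(item stmt-SmoothPoincare4-10894, routes `CongruenceShadows` / `GroupTrisection`; lead reshape r1;
checked skeleton `Cruxes/AgkCor6Sufficiency/Lines/lp-by-sphere-system-surgery.lean`)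

**Handlebody extension** (`HandlebodyExtension`, the line's statement, declared here verbatim from
the skeleton): a diffeomorphism `ψ : ∂H ≅ ∂H'` between the boundary surfaces of two compact
connected orientable `3`-dimensional handlebodies with one `0`-handle and `g` `1`-handles that
carries `ker (π₁ ∂H → π₁ H)` onto `ker (π₁ ∂H' → π₁ H')` extends to a diffeomorphism `H ≅ H'`.

It is proved here FROM **Griffiths' theorem in extension form** (`GriffithsExtension`, the
statement of the line's delegated fact `stub_griffiths`, declared here verbatim from the skeleton
and taken as the HYPOTHESIS of the stub; H. B. Griffiths, *Automorphisms of a 3-dimensional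
handlebody*, Abh. Math. Sem. Univ. Hamburg 26 (1964) 191–210: a kernel-preserving
self-diffeomorphism of the boundary of ONE genus-`g` handlebody extends over it), by pure glue:

* `handlebodyExtension_of_griffiths` — with `Θ : H ≅ H'` from the tree's PROVED classification of
  genus-`g` handlebodies (UNIQ, `IsHandlebody.nonempty_diffeomorph_of_oneHandle` fed with
  `oneHandle_nonempty_diffeomorph_holds`), the self-diffeomorphism `∂Θ⁻¹ ∘ ψ` of `∂H` is again
  kernel-preserving (necessity of the kernel condition, `map_ker_eq_ker_of_extends'`, functoriality
  of `π₁`), so Griffiths' theorem extends it to `Ξ : H ≅ H`, and `Θ ∘ Ξ` extends `ψ`;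
* `stub_handlebodyExtension : Literature.Topology.FourManifolds.GriffithsExtension → HandlebodyExtension` — the registered stub: the
  line's unbundled hypotheses (`HasHandleDecomposition 2 H (handleCount 1 g)`, `IsOrientable`,
  `[CompactSpace H]`, `[ConnectedSpace H]`) are exactly `IsHandlebody g H`;
* `handlebodyExtension_zero` — genus `0` UNCONDITIONALLY (any `ψ`): both handlebodies are `D³`
  (UNIQ against `isHandlebody_zero_closedBall`) and `Γ₃ = 0` (`extendsOverBall_two`, proved).

No `sorry`; the only unproved input is the hypothesis `GriffithsExtension` (cited, for relocation to
`Literature/Topology/FourManifolds/`).  The `π₁` bookkeeping (`map_ker_eq_ker_of_extends'`) is a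
private copy of `Summit.SmoothPoincare4.SmoothPoincare4.Theorems.AgkCor6Sufficiency.Negative.map_ker_eq_ker_of_extends`
(`Theorems/AgkCor6Sufficiency/Negative/KernelNecessity.lean`), re-proved from Mathlib's
`FundamentalGroup.map` alone so that this file imports no freshly landed module.
-/

noncomputable section

-- the prescribed namespace `Summit.<P>.<Sub>.…` duplicates `SmoothPoincare4` (P = Sub)
set_option linter.dupNamespace false

namespace Summit.SmoothPoincare4.SmoothPoincare4.Cruxes.AgkCor6Sufficiency.LpBySphereSystemSurgery

open Set Function
-- `_root_`-qualified on purpose: the gate relocates the cited fact `GriffithsExtension` below into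
-- `namespace Literature.Topology.FourManifolds`, copying these `open`s, and there the bare names
-- `Manifold`, `ContDiff`, `Topology` resolve to the nested namespaces
-- `Literature.Topology.FourManifolds.Manifold` etc. (dot-notation lemmas), which would leave the
-- scoped notations `𝓡∂`, `𝓡`, `≃ₘ⟮_,_⟯`, `∞` closed.
open scoped _root_.Manifold _root_.ContDiff _root_.Topology
open Literature.Topology.FourManifolds

/-- **Handlebody extension** (Griffiths 1964; Zieschang; Johannson): a diffeomorphism between the
boundary surfaces of two compact connected orientable `3`-dimensional handlebodies of genus `g`
(one `0`-handle, `g` `1`-handles) that carries the kernel of `π₁(∂H) → π₁(H)` onto the kernel of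
`π₁(∂H') → π₁(H')` extends to a diffeomorphism `H ≅ H'`.  (Meridian curves go to curves bounding
discs — handlebody disc lemma —, cut to `3`-balls — Alexander —, extend over the balls —
`Γ₃ = 0`, proved.)  Statement of the line's skeleton, verbatim. -/
def HandlebodyExtension : Prop :=
  ∀ (g : ℕ) (H H' : Type) [TopologicalSpace H] [T2Space H] [SecondCountableTopology H]
    [CompactSpace H] [ConnectedSpace H] [ChartedSpace (EuclideanHalfSpace 3) H]
    [IsManifold (𝓡∂ 3) ∞ H]
    [TopologicalSpace H'] [T2Space H'] [SecondCountableTopology H'] [CompactSpace H']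
    [ConnectedSpace H'] [ChartedSpace (EuclideanHalfSpace 3) H'] [IsManifold (𝓡∂ 3) ∞ H']
    (_ : HasHandleDecomposition 2 H (handleCount 1 g))
    (_ : HasHandleDecomposition 2 H' (handleCount 1 g))
    (_ : IsOrientable (𝓡∂ 3) H) (_ : IsOrientable (𝓡∂ 3) H')
    (b : BoundaryData (𝓡∂ 3) H (𝓡 2)) (b' : BoundaryData (𝓡∂ 3) H' (𝓡 2))
    (ψ : b.carrier ≃ₘ⟮𝓡 2, 𝓡 2⟯ b'.carrier) (z₀ : b.carrier),
    ((FundamentalGroup.map (⟨b.incl, b.continuous_incl⟩ : C(b.carrier, H)) z₀).ker).map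
        (FundamentalGroup.map (⟨ψ, ψ.continuous⟩ : C(b.carrier, b'.carrier)) z₀) =
      (FundamentalGroup.map (⟨b'.incl, b'.continuous_incl⟩ : C(b'.carrier, H')) (ψ z₀)).ker →
    ∃ Ψ : H ≃ₘ⟮𝓡∂ 3, 𝓡∂ 3⟯ H', ⇑Ψ ∘ b.incl = b'.incl ∘ ⇑ψ

/-! ## `π₁` bookkeeping: functoriality and kernels along a commuting square -/

section PiOne

variable {X X' Y Y' : Type*} [TopologicalSpace X] [TopologicalSpace X'] [TopologicalSpace Y]
  [TopologicalSpace Y']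

/-- Functoriality of `FundamentalGroup.map`: `(g ∘ f)_* = g_* ∘ f_*` (Hatcher, §1.1, p. 34). [folklore] -/
private theorem map_comp_apply (f : C(X, Y)) (g : C(Y, Y')) (x : X) (γ : FundamentalGroup X x) :
    FundamentalGroup.map (g.comp f) x γ =
      FundamentalGroup.map g (f x) (FundamentalGroup.map f x γ) := by
  induction γ using Quotient.ind with
  | _ ℓ => rfl

/-- The identity induces the identity of `π₁(X, x)`. [folklore] -/
private theorem map_id_apply (x : X) (γ : FundamentalGroup X x) :
    FundamentalGroup.map (ContinuousMap.id X) x γ = γ := by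
  induction γ using Quotient.ind with
  | _ ℓ => exact congrArg (fun p : Path x x => (⟦p⟧ : Path.Homotopic.Quotient x x)) (Path.map_id ℓ)

/-- Equal maps have the same kernel on `π₁` (stated through `f = g`, so that the base points
`f x`, `g x` need not be compared). [folklore] -/
private theorem map_eq_one_of_eq {f g : C(X, Y)} (h : f = g) {x : X} {γ : FundamentalGroup X x}
    (h1 : FundamentalGroup.map f x γ = 1) : FundamentalGroup.map g x γ = 1 := by
  subst h
  exact h1

/-- A self-map equal to the identity induces an injection on `π₁(X, x)`. [folklore] -/
private theorem map_injective_of_eq_id {f : C(X, X)} (hf : f = ContinuousMap.id X) (x : X) :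
    Function.Injective (FundamentalGroup.map f x) := by
  subst hf
  intro p q h
  rwa [map_id_apply, map_id_apply] at h

/-- A self-map equal to the identity induces a surjection on `π₁(X, x)`. [folklore] -/
private theorem map_surjective_of_eq_id {f : C(X, X)} (hf : f = ContinuousMap.id X) (x : X) :
    Function.Surjective (FundamentalGroup.map f x) := by
  subst hf
  exact fun q => ⟨q, map_id_apply x q⟩

/-- A homeomorphism induces an injection `e_* : π₁(X, x) → π₁(X', e x)` (Hatcher, §1.1). [folklore] -/
private theorem map_injective_homeomorph (e : X ≃ₜ X') (x : X) :
    Function.Injective (FundamentalGroup.map (e : C(X, X')) x) := by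
  intro p q h
  have h' := congrArg (FundamentalGroup.map (e.symm : C(X', X)) ((e : C(X, X')) x)) h
  rw [← map_comp_apply, ← map_comp_apply] at h'
  exact map_injective_of_eq_id (f := (e.symm : C(X', X)).comp (e : C(X, X')))
    (ContinuousMap.ext fun y => e.symm_apply_apply y) x h'

/-- A homeomorphism induces a surjection `e_* : π₁(X, x) → π₁(X', e x)` (Hatcher, §1.1). [folklore] -/
private theorem map_surjective_homeomorph (e : X ≃ₜ X') (x : X) :
    Function.Surjective (FundamentalGroup.map (e : C(X, X')) x) := by
  have hs : Function.Surjective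
      (FundamentalGroup.map (e : C(X, X')) ((e.symm : C(X', X)) ((e : C(X, X')) x))) := by
    intro q
    obtain ⟨p, hp⟩ := map_surjective_of_eq_id (f := (e : C(X, X')).comp (e.symm : C(X', X)))
      (ContinuousMap.ext fun y => e.apply_symm_apply y) ((e : C(X, X')) x) q
    rw [map_comp_apply] at hp
    exact ⟨_, hp⟩
  have hex : (e.symm : C(X', X)) ((e : C(X, X')) x) = x := e.symm_apply_apply x
  rwa [hex] at hs

/-- **Kernels along a commuting square with homeomorphisms** (Hatcher, *Algebraic Topology*
(2002), §1.1, p. 34 and Prop. 1.18): for continuous `i : X → Y`, `i' : X' → Y'` and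
homeomorphisms `φ : X ≃ₜ X'`, `Φ : Y ≃ₜ Y'` with `Φ ∘ i = i' ∘ φ`, the induced map `φ_*` carries
`ker (i_* : π₁(X, x₀) → π₁(Y, i x₀))` ONTO `ker (i'_* : π₁(X', φ x₀) → π₁(Y', i' (φ x₀)))`.
-- copied (re-proved on `FundamentalGroup.map`) from `Theorems/AgkCor6Sufficiency/Negative/KernelNecessity.lean`
[cite: HatcherAT2002, §1.1 (p. 34) and Prop. 1.18] -/
private theorem map_ker_eq_ker_of_semiconj' (i : C(X, Y)) (i' : C(X', Y')) (φ : X ≃ₜ X')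
    (Φ : Y ≃ₜ Y') (h : ∀ x, Φ (i x) = i' (φ x)) (x₀ : X) :
    ((FundamentalGroup.map i x₀).ker).map (FundamentalGroup.map (φ : C(X, X')) x₀) =
      (FundamentalGroup.map i' ((φ : C(X, X')) x₀)).ker := by
  have hc : (Φ : C(Y, Y')).comp i = i'.comp (φ : C(X, X')) :=
    ContinuousMap.ext fun x => h x
  -- kernel membership is transported both ways along the square
  have key : ∀ γ : FundamentalGroup X x₀, FundamentalGroup.map i x₀ γ = 1 ↔
      FundamentalGroup.map i' ((φ : C(X, X')) x₀)
        (FundamentalGroup.map (φ : C(X, X')) x₀ γ) = 1 := by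
    intro γ
    constructor
    · intro hγ
      have h1 : FundamentalGroup.map (Φ : C(Y, Y')) (i x₀) (FundamentalGroup.map i x₀ γ) = 1 := by
        rw [hγ, map_one]
      have h2 : FundamentalGroup.map ((Φ : C(Y, Y')).comp i) x₀ γ = 1 :=
        (map_comp_apply i (Φ : C(Y, Y')) x₀ γ).trans h1
      have h3 : FundamentalGroup.map (i'.comp (φ : C(X, X'))) x₀ γ = 1 := map_eq_one_of_eq hc h2
      exact (map_comp_apply (φ : C(X, X')) i' x₀ γ).symm.trans h3
    · intro hγ
      have h3 : FundamentalGroup.map (i'.comp (φ : C(X, X'))) x₀ γ = 1 :=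
        (map_comp_apply (φ : C(X, X')) i' x₀ γ).trans hγ
      have h2 : FundamentalGroup.map ((Φ : C(Y, Y')).comp i) x₀ γ = 1 :=
        map_eq_one_of_eq hc.symm h3
      have h1 : FundamentalGroup.map (Φ : C(Y, Y')) (i x₀) (FundamentalGroup.map i x₀ γ) = 1 :=
        (map_comp_apply i (Φ : C(Y, Y')) x₀ γ).symm.trans h2
      exact map_injective_homeomorph Φ (i x₀) (h1.trans (map_one _).symm)
  ext δ
  simp only [Subgroup.mem_map, MonoidHom.mem_ker]
  constructor
  · rintro ⟨γ, hγ, rfl⟩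
    exact (key γ).1 hγ
  · intro hδ
    obtain ⟨γ, rfl⟩ := map_surjective_homeomorph φ x₀ δ
    exact ⟨γ, (key γ).2 hδ, rfl⟩

end PiOne

/-- **The kernel condition is necessary** (shape of `HandlebodyExtension`): if a diffeomorphism
`Φ : H ≅ H'` of `3`-manifolds with boundary extends the boundary diffeomorphism `φ`
(`Φ ∘ incl = incl' ∘ φ`), then `φ_*` maps `ker (π₁ ∂H → π₁ H)` onto `ker (π₁ ∂H' → π₁ H')`.
-- copied from `Theorems/AgkCor6Sufficiency/Negative/KernelNecessity.lean` (`map_ker_eq_ker_of_extends`),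
-- private here so that this file does not import that freshly landed module
[cite: HatcherAT2002, §1.1 (p. 34) and Prop. 1.18] -/
private theorem map_ker_eq_ker_of_extends' {H H' : Type*} [TopologicalSpace H]
    [ChartedSpace (EuclideanHalfSpace 3) H] [TopologicalSpace H']
    [ChartedSpace (EuclideanHalfSpace 3) H']
    (b : BoundaryData (𝓡∂ 3) H (𝓡 2)) (b' : BoundaryData (𝓡∂ 3) H' (𝓡 2))
    (φ : b.carrier ≃ₘ⟮𝓡 2, 𝓡 2⟯ b'.carrier) (Φ : H ≃ₘ⟮𝓡∂ 3, 𝓡∂ 3⟯ H')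
    (hΦ : ⇑Φ ∘ b.incl = b'.incl ∘ ⇑φ) (x₀ : b.carrier) :
    ((FundamentalGroup.map (⟨b.incl, b.continuous_incl⟩ : C(b.carrier, H)) x₀).ker).map
        (FundamentalGroup.map (⟨φ, φ.continuous⟩ : C(b.carrier, b'.carrier)) x₀)
      = (FundamentalGroup.map (⟨b'.incl, b'.continuous_incl⟩ : C(b'.carrier, H'))
          ((⟨φ, φ.continuous⟩ : C(b.carrier, b'.carrier)) x₀)).ker :=
  map_ker_eq_ker_of_semiconj' ⟨b.incl, b.continuous_incl⟩ ⟨b'.incl, b'.continuous_incl⟩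
    φ.toHomeomorph Φ.toHomeomorph (fun x => congrFun hΦ x) x₀

/-! ## Handlebody extension from Griffiths' theorem (UNIQ + necessity of the kernel condition) -/

/-- **Handlebody extension from Griffiths' theorem, `IsHandlebody` form**: for genus-`g`
handlebodies `H, H'`, a kernel-preserving `φ : ∂H ≅ ∂H'` extends to `H ≅ H'`.  With `Θ : H ≅ H'`
(UNIQ, `IsHandlebody.nonempty_diffeomorph_of_oneHandle oneHandle_nonempty_diffeomorph_holds`) and
`ψ := ∂Θ⁻¹ ∘ φ` (kernel-preserving by `map_ker_eq_ker_of_extends'`), Griffiths' theorem gives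
`Ξ : H ≅ H` extending `ψ`, and `Θ ∘ Ξ` extends `φ`.
-- adapted from the wave-1 work file `stub_handlebodyKernelExtension.lean` (`handlebodyKernelExtension_of_griffiths`)
[cite: GriffithsHB1964Handlebody, main theorem] -/
theorem handlebodyExtension_of_griffiths (hG : Literature.Topology.FourManifolds.GriffithsExtension) (g : ℕ)
    (H : Type) [TopologicalSpace H] [T2Space H] [SecondCountableTopology H]
    [ChartedSpace (EuclideanHalfSpace 3) H] [IsManifold (𝓡∂ 3) ∞ H]
    (H' : Type) [TopologicalSpace H'] [T2Space H'] [SecondCountableTopology H']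
    [ChartedSpace (EuclideanHalfSpace 3) H'] [IsManifold (𝓡∂ 3) ∞ H']
    (hH : IsHandlebody g H) (hH' : IsHandlebody g H')
    (b : BoundaryData (𝓡∂ 3) H (𝓡 2)) (b' : BoundaryData (𝓡∂ 3) H' (𝓡 2))
    (φ : b.carrier ≃ₘ⟮𝓡 2, 𝓡 2⟯ b'.carrier) (x₀ : b.carrier)
    (hker : ((FundamentalGroup.map (⟨b.incl, b.continuous_incl⟩ : C(b.carrier, H)) x₀).ker).map
        (FundamentalGroup.map (⟨φ, φ.continuous⟩ : C(b.carrier, b'.carrier)) x₀)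
      = (FundamentalGroup.map (⟨b'.incl, b'.continuous_incl⟩ : C(b'.carrier, H'))
          ((⟨φ, φ.continuous⟩ : C(b.carrier, b'.carrier)) x₀)).ker) :
    ∃ Φ : H ≃ₘ⟮𝓡∂ 3, 𝓡∂ 3⟯ H', ⇑Φ ∘ b.incl = b'.incl ∘ ⇑φ := by
  obtain ⟨Θ⟩ := IsHandlebody.nonempty_diffeomorph_of_oneHandle oneHandle_nonempty_diffeomorph_holds
    g H H' hH hH'
  set θ := b.restrictDiffeomorph b' Θ with hθ
  have hΘs : ⇑Θ.symm ∘ b'.incl = b.incl ∘ ⇑θ.symm := by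
    funext w
    have h := BoundaryData.incl_restrictDiffeomorph (b₁ := b) (b₂ := b') Θ (θ.symm w)
    rw [← hθ, Diffeomorph.apply_symm_apply] at h
    simp only [Function.comp_apply]
    rw [h, Diffeomorph.symm_apply_apply]
  have hker' := map_ker_eq_ker_of_extends' b' b θ.symm Θ.symm hΘs (φ x₀)
  set ψ : b.carrier ≃ₘ⟮𝓡 2, 𝓡 2⟯ b.carrier := φ.trans θ.symm with hψ
  have hkerψ : ((FundamentalGroup.map (⟨b.incl, b.continuous_incl⟩ : C(b.carrier, H)) x₀).ker).map
        (FundamentalGroup.map (⟨ψ, ψ.continuous⟩ : C(b.carrier, b.carrier)) x₀)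
      = (FundamentalGroup.map (⟨b.incl, b.continuous_incl⟩ : C(b.carrier, H))
          ((⟨ψ, ψ.continuous⟩ : C(b.carrier, b.carrier)) x₀)).ker := by
    have hfun : FundamentalGroup.map (⟨ψ, ψ.continuous⟩ : C(b.carrier, b.carrier)) x₀ =
        (FundamentalGroup.map (⟨θ.symm, θ.symm.continuous⟩ : C(b'.carrier, b.carrier)) (φ x₀)).comp
          (FundamentalGroup.map (⟨φ, φ.continuous⟩ : C(b.carrier, b'.carrier)) x₀) :=
      MonoidHom.ext fun p => map_comp_apply
        (⟨φ, φ.continuous⟩ : C(b.carrier, b'.carrier))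
        (⟨θ.symm, θ.symm.continuous⟩ : C(b'.carrier, b.carrier)) x₀ p
    rw [hfun]
    refine (Subgroup.map_map _ _ _).symm.trans ?_
    rw [hker]
    exact hker'
  obtain ⟨Ξ, hΞ⟩ := hG g H hH b ψ x₀ hkerψ
  refine ⟨Ξ.trans Θ, funext fun z => ?_⟩
  have hz : Ξ (b.incl z) = b.incl (ψ z) := congrFun hΞ z
  simp only [Function.comp_apply, Diffeomorph.coe_trans, hz]
  have h := BoundaryData.incl_restrictDiffeomorph (b₁ := b) (b₂ := b') Θ (ψ z)
  rw [← hθ] at h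
  rw [← h, hψ, Diffeomorph.coe_trans, Function.comp_apply, Diffeomorph.apply_symm_apply]

/-- **The registered stub: handlebody extension from Griffiths' theorem.**  The line's unbundled
hypotheses — `[CompactSpace H]`, `[ConnectedSpace H]`, `IsOrientable (𝓡∂ 3) H`,
`HasHandleDecomposition 2 H (handleCount 1 g)` — are by definition `IsHandlebody g H`
(`LickorishWallace.lean`), so this is `handlebodyExtension_of_griffiths`.
[cite: GriffithsHB1964Handlebody, main theorem] -/
theorem stub_handlebodyExtension :
    Literature.Topology.FourManifolds.GriffithsExtension → HandlebodyExtension := by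
  intro hG g H H' _ _ _ _ _ _ _ _ _ _ _ _ _ _ hd hd' ho ho' b b' ψ z₀ hker
  exact handlebodyExtension_of_griffiths hG g H H' ⟨inferInstance, inferInstance, ho, hd⟩
    ⟨inferInstance, inferInstance, ho', hd'⟩ b b' ψ z₀ hker

/-! ## Genus zero, unconditionally: `Γ₃ = 0` -/

/-- **Handlebody extension in genus `0`, unconditionally** (any `φ`, no kernel condition, no
Griffiths): both handlebodies are closed `3`-balls (UNIQ against `isHandlebody_zero_closedBall`),
and `φ`, conjugated by `∂Ψ`, `∂Ψ'` to a self-diffeomorphism of `S²`, extends over `D³` by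
`Γ₃ = 0` (`extendsOverBall_two`, Smale–Munkres–Cerf, proved in the tree).
-- adapted from the wave-1 work file `stub_handlebodyKernelExtension.lean` (`handlebodyKernelExtension_zero`)
[cite: CerfDiffeoSphere1968, Appendice §5, Corollaire 3] -/
theorem handlebodyExtension_zero
    (H : Type) [TopologicalSpace H] [T2Space H] [SecondCountableTopology H]
    [ChartedSpace (EuclideanHalfSpace 3) H] [IsManifold (𝓡∂ 3) ∞ H]
    (H' : Type) [TopologicalSpace H'] [T2Space H'] [SecondCountableTopology H']
    [ChartedSpace (EuclideanHalfSpace 3) H'] [IsManifold (𝓡∂ 3) ∞ H']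
    (hH : IsHandlebody 0 H) (hH' : IsHandlebody 0 H')
    (b : BoundaryData (𝓡∂ 3) H (𝓡 2)) (b' : BoundaryData (𝓡∂ 3) H' (𝓡 2))
    (φ : b.carrier ≃ₘ⟮𝓡 2, 𝓡 2⟯ b'.carrier) :
    ∃ Φ : H ≃ₘ⟮𝓡∂ 3, 𝓡∂ 3⟯ H', ⇑Φ ∘ b.incl = b'.incl ∘ ⇑φ := by
  obtain ⟨Ψ⟩ := IsHandlebody.nonempty_diffeomorph_of_oneHandle oneHandle_nonempty_diffeomorph_holds
    0 H (Metric.closedBall (0 : EuclideanSpace ℝ (Fin 3)) 1) hH isHandlebody_zero_closedBall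
  obtain ⟨Ψ'⟩ := IsHandlebody.nonempty_diffeomorph_of_oneHandle oneHandle_nonempty_diffeomorph_holds
    0 H' (Metric.closedBall (0 : EuclideanSpace ℝ (Fin 3)) 1) hH' isHandlebody_zero_closedBall
  set b₀ : BoundaryData (𝓡∂ 3) (Metric.closedBall (0 : EuclideanSpace ℝ (Fin 3)) 1) (𝓡 2) :=
    closedBallBoundaryData 2 with hb₀
  set ψ := b.restrictDiffeomorph b₀ Ψ with hψ
  set ψ' := b'.restrictDiffeomorph b₀ Ψ' with hψ'
  set χ : b₀.carrier ≃ₘ⟮𝓡 2, 𝓡 2⟯ b₀.carrier := ψ.symm.trans (φ.trans ψ') with hχ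
  obtain ⟨Χ, hΧ⟩ := extendsOverBall_two χ
  refine ⟨Ψ.trans (Χ.trans Ψ'.symm), funext fun z => ?_⟩
  have h1 : Ψ (b.incl z) = b₀.incl (ψ z) := (BoundaryData.incl_restrictDiffeomorph Ψ z).symm
  have h2 : Ψ' (b'.incl (φ z)) = b₀.incl (ψ' (φ z)) :=
    (BoundaryData.incl_restrictDiffeomorph Ψ' (φ z)).symm
  have h3 : χ (ψ z) = ψ' (φ z) := by
    simp only [hχ, Diffeomorph.coe_trans, Function.comp_apply, Diffeomorph.symm_apply_apply]
  simp only [Function.comp_apply, Diffeomorph.coe_trans]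
  rw [h1]
  have h4 : Χ (b₀.incl (ψ z)) = b₀.incl (χ (ψ z)) := hΧ (ψ z)
  rw [h4, h3, ← h2, Diffeomorph.symm_apply_apply]

/-- **Genus-`0` case of the line's statement, unconditionally** (no Griffiths): the instance of
`HandlebodyExtension` at `g = 0` holds outright, by `handlebodyExtension_zero`.
[cite: CerfDiffeoSphere1968, Appendice §5, Corollaire 3] -/
theorem handlebodyExtension_genus_zero
    (H H' : Type) [TopologicalSpace H] [T2Space H] [SecondCountableTopology H]
    [CompactSpace H] [ConnectedSpace H] [ChartedSpace (EuclideanHalfSpace 3) H]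
    [IsManifold (𝓡∂ 3) ∞ H]
    [TopologicalSpace H'] [T2Space H'] [SecondCountableTopology H'] [CompactSpace H']
    [ConnectedSpace H'] [ChartedSpace (EuclideanHalfSpace 3) H'] [IsManifold (𝓡∂ 3) ∞ H']
    (hd : HasHandleDecomposition 2 H (handleCount 1 0))
    (hd' : HasHandleDecomposition 2 H' (handleCount 1 0))
    (ho : IsOrientable (𝓡∂ 3) H) (ho' : IsOrientable (𝓡∂ 3) H')
    (b : BoundaryData (𝓡∂ 3) H (𝓡 2)) (b' : BoundaryData (𝓡∂ 3) H' (𝓡 2))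
    (ψ : b.carrier ≃ₘ⟮𝓡 2, 𝓡 2⟯ b'.carrier) :
    ∃ Ψ : H ≃ₘ⟮𝓡∂ 3, 𝓡∂ 3⟯ H', ⇑Ψ ∘ b.incl = b'.incl ∘ ⇑ψ :=
  handlebodyExtension_zero H H' ⟨inferInstance, inferInstance, ho, hd⟩
    ⟨inferInstance, inferInstance, ho', hd'⟩ b b' ψ

end Summit.SmoothPoincare4.SmoothPoincare4.Cruxes.AgkCor6Sufficiency.LpBySphereSystemSurgery

end
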